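import Literature.MathematicalPhysics.QuantumFieldTheory.Balaban1983to89.B1Eq324BenfattoSect5PolyClusters
import Literature.MathematicalPhysics.QuantumFieldTheory.Balaban1983to89.B1Eq324BenfattoSect5LegGeometry
import HarnessLib

/-!
# `Balaban1983to89.B1Eq324BenfattoSect5TupleClusters` — [BenfattoEtAl1978] §5 (5.29)/(5.31) p. 158 and Appendix D p. 166 in the
# boxes line's TUPLE vocabulary: for slots that are tuple-class sums of the (5.5)-terms, `Y_j = Σ_pΣ_{Δ∈T_j p}Σ_n A^n_Δ e^{−(ϰ/2)d(Δ)} Π z_{Δᵢ}^{nᵢ}`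
# (`Ψ′₁`, `Ψ″₁`, `Ψ₂`, `H_R`, `H_{R,S}` …), the conditioned-versus-free comparison and the UNIFORM Appendix D clustering bound under
# `P̄(dz|z̄_Γ)` — `B1Eq324BenfattoSect5PolyClusters` re-indexed, the intra-cluster sum absorbed by the coefficient decay — PROVED

statement-level skeleton of published theorems with citation tags; proofs where landed; nothing here is a claim about the
Yang–Mills mass gap

WHY THIS MODULE (cell `pub-ymgap`, seat `dag-n08-c`, node N08; the ADAPTER between `…Sect5PolyClusters` (slots `Σ_c a_{jc}·Π_{l} z(x_{jcl})`
over a Fintype `ι`) and the vocabulary in which the boxes line writes print's slots (`B1Eq324BenfattoSect5Eq511.term`, tuple classes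
`T p ⊆ (Fin p → J)`: `hamiltonian_eq_sum_tuplesIn`, `interaction_eq_sum_crossT`, `psi1pp_eq_sum`, `psi3_eq_sum`), and the UNIFORM form of
Appendix D that the per-box hypotheses `h29` of `B1Eq324BenfattoSect5PerBox.abs_log_integral_perBox_le_of_colourings` and the anchored
CROSS sums of `…Sect5FreeCumulants` consume).  Print, p. 158: the second term of (5.29), `s₄(s₂b^{D+2d}A)^k e^{−ϰ̃b^{3/2}}`, comes *"from the
properties of the conditioned measure and from the Wick theorem (see Appendix D)"*; Appendix D (p. 166): *"the exponential factors … give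
rise to an overall dumping factor"* — between a leg of `Ψ″₁` (in `□′∖Γ₄(□)`) and a leg of `Ψ₂` (in `Γ₁(□)∪Γ₂(□)`), at `ℓ¹` distance `≥ v + 1`
(`B1Eq324BenfattoSect5LegGeometry.le_l1_core_sdiff_frame4_of_not_mem_core`), while the SAME-cluster `ℓ¹` spread of a monomial is paid by the
coefficient decay `e^{−(ϰ/2)d(Δ)}` of (4.5) (`…LegGeometry.l1_le_sqrt_mul_connLength_add`: `ℓ¹(Δ_a,Δ_b) ≤ √d·d(Δ) + d`).

THE RE-INDEXING.  All slots draw their monomials from ONE finite index set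
`U = (Icc 1 s).sigma (p ↦ (univ.filter (Δ ↦ ∃ j, Δ ∈ T_j p)) ×ˢ admissible p D)` (tuples appearing in SOME class), with the coefficient of
slot `j` at `c = (p, Δ, n)` equal to `𝟙[Δ ∈ T_j p]·A^n_Δ·e^{−(ϰ/2)d(Δ)}`, the legs `(i, r)`, `r < nᵢ` (`…SlotMoments.legPairs_injective`) at the
tesserae `Δᵢ`; every tessera of an admissible tuple carries a leg (`nᵢ > 0`), and a tuple has `Σᵢnᵢ ≤ D` legs.

WHAT IS PROVED (theorems only; no definition, no named fact, no `sorry`; axioms standard).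
* §1 `tupleSum_eq_sum_subtype` / `tupleSum_eq_sum_option` (the slot as a `Σ_{c : ↥U}` resp. `Σ_{c : Option ↥U}` polynomial — the dummy
  index `none` has coefficient `0` and no legs, so the index type is never empty), `sum_abs_tcoef_mul_eq` (its coefficient mass with an
  arbitrary tuple weight `ω`: `Σ_c |a_j(c)|·ω(c) = Σ_pΣ_{Δ∈T_j p}Σ_n |A^n_Δ|e^{−(ϰ/2)d(Δ)}·ω`), `card_legs_le_of_mem` (`≤ D` legs),
  `site_of_mem_legs` (a leg sits at a tessera of its tuple), `leg_mem_legs_of_mem` (every tessera carries the leg `(i, 0)`).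
* §2 ★ **`abs_ursellOf_tupleSums_condField_sub_P0_le`** — (5.31) «(error)» for tuple-class slots: if on every tessera `x` of every tuple of
  every class `|u(x)| ≤ ε`, `|C^Γ(x,y) − C(x,y)| ≤ ε` and `|u|,|C^Γ|,|C| ≤ R` (`R ≥ 1`), then
  `|𝓔^T_{z̄}(Y₁,…,Y_k) − 𝓔^T_0(Y₁,…,Y_k)| ≤ (Π_j 𝓜_j)·2^{kD}2^{2^{kD}}·kD·R^{kD}·ε`, `𝓜_j = Σ|A^n_Δ|e^{−(ϰ/2)d(Δ)}` over `T_j`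
  (`…PolyClusters.abs_ursellOf_poly_condField_sub_P0_le`).
* §3 `l1_site_pseudo`, `sum_sum_l1_legs_le` (the intra-cluster `ℓ¹` sum of one admissible tuple is `≤ D²(√d·d(Δ) + d)`), `appDConst_mono`,
  ★ `abs_ursellOf_poly_condField_le_exp_of_separated` (UNIFORM Appendix D for generic polynomial slots over a finite index: zero
  coefficient or a designated separated pair of legs, colouring by colouring), ★★ **`abs_ursellOf_tupleSums_condField_le_exp_of_separated`**
  — UNIFORM APPENDIX D FOR TUPLE-CLASS SLOTS: if two slots `j₁`, `j₂` have classes all of whose tuples meet regions `R_A` resp. `R_B` with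
  `ℓ¹(R_A, R_B) ≥ ρ₀`, `d ≥ 1`, `|u| ≤ K₀` on the tuples' tesserae and `K₀ ≥ max(1, C₀₀)`, then for ANY rate
  `0 ≤ δ ≤ log((2d+α²)/(2d))`: `|𝓔^T_{z̄}(Y₁,…,Y_k)| ≤ 2^{kD}·2^{2^{kD}}·K₀^{kD}·e^{−(δ/2)ρ₀}·Π_j 𝓜̃_j`,
  `𝓜̃_j = Σ_{T_j}|A^n_Δ|e^{−(ϰ/2)d(Δ)}·e^{(δ/2)D²(√d·d(Δ)+d)}` (summable against the coefficient decay when `δD²√d < ϰ` — print's `ϰ̃`).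

HONEST SCOPE / NOT HERE.  The lattice sums bounding `𝓜_j`, `𝓜̃_j` by `s·A·|R|`-type numbers (`…Sect5Eq511.sum_exp_quarter_le` at the
residual rate `ϰ/2 − (δ/2)D²√d > 0`), the χ-weights (removed by `…ChiToOneOnData`), the choice `R_A = □′∖Γ₄(□)`, `R_B = Γ₁(□)∪Γ₂(□)`,
`ρ₀ = v + 1` for `h29`, the ε of §2 from `…LegGeometry` §3–§4, and the per-box / pavement assembly are the boxes line's and the assembly's;
`BasicLemmaPrinted` stays OPEN.  NOT summit progress; count-neutral for N08; nothing of [Balaban1985UV3] is asserted.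
-/

open Finset MeasureTheory
open scoped BigOperators

namespace Literature.MathematicalPhysics.QuantumFieldTheory.Balaban1983to89.B1Eq324BenfattoSect5TupleClusters

open _root_.MeasureTheory _root_.ProbabilityTheory
open Literature.Probability.LatticeModels (ursellOf)
open Literature.MathematicalPhysics.QuantumFieldTheory
open Literature.MathematicalPhysics.QuantumFieldTheory.Balaban1983to89.B1Eq324BenfattoLemma
open Literature.MathematicalPhysics.QuantumFieldTheory.Balaban1983to89.B1Eq324BenfattoConnLength (connLength_nonneg)
open Literature.MathematicalPhysics.QuantumFieldTheory.Balaban1983to89.B1Eq324BenfattoSect5Eq511 (term)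
open Literature.MathematicalPhysics.QuantumFieldTheory.Balaban1983to89.B1Eq324BenfattoSect5SlotMoments
  (legPairs_injective prod_pow_eq_prod_legs card_legs)
open Literature.MathematicalPhysics.QuantumFieldTheory.Balaban1983to89.B1Eq324BenfattoSect5PolyClusters
  (abs_ursellOf_poly_condField_sub_P0_le abs_ursellOf_monomials_condField_le_exp ursellOf_poly_eq_sum_colourings
   sum_prod_abs_eq_prod_sum integrable_abs_monomial_pow_condField measurable_monomial)
open Literature.MathematicalPhysics.QuantumFieldTheory.Balaban1983to89.B1Eq324BenfattoAppendixDWick (abs_condCov_le_exp_l1)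
open Literature.MathematicalPhysics.QuantumFieldTheory.Balaban1983to89.B1Eq324BenfattoSect5LegGeometry (l1_le_sqrt_mul_connLength_add)
open Literature.MathematicalPhysics.QuantumFieldTheory.Balaban1983to89.B1Eq324BenfattoMarkov (isProbabilityMeasure_condField)

variable {d : ℕ} {α β : ℝ} {s D : ℕ} {ϰ : ℝ} {a : Coef d} {Jr : Finset (B1Eq324BenfattoLemma.Site d)}
variable {σ : Type} [Fintype σ]

/-! ## §1  Tuple-class slots as polynomials over one finite index set -/

section Reindex

/-- **A TUPLE-CLASS SLOT AS A POLYNOMIAL OVER THE COMMON FINITE INDEX `U`** (tuples appearing in some class, admissible exponents):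
`Σ_{p∈Icc 1 s} Σ_{Δ∈T_j p} Σ_{n∈admissible p D} A^n_Δ e^{−(ϰ/2)d(Δ)} Π z_{Δᵢ}^{nᵢ} = Σ_{c : ↥U} a_j(c)·Π_{(i,r)} z(Δᵢ)`,
`a_j(c) = 𝟙[Δ ∈ T_j p]·A^n_Δ·e^{−(ϰ/2)d(Δ)}` (legs as in `…SlotMoments.prod_pow_eq_prod_legs`). [cite: BenfattoEtAl1978, (5.5) p.154 and (2.7) p.147] -/
theorem tupleSum_eq_sum_subtype (T : σ → (p : ℕ) → Finset (Fin p → Jr)) (j : σ) (z : B1Eq324BenfattoLemma.Site d → ℝ) :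
    ∑ p ∈ Finset.Icc 1 s, ∑ Δ ∈ T j p, ∑ n ∈ admissible p D, term ϰ a z p Δ n =
      ∑ c : ↥((Finset.Icc 1 s).sigma fun p =>
          (Finset.univ.filter fun Δ : Fin p → Jr => ∃ j', Δ ∈ T j' p) ×ˢ admissible p D),
        (if c.1.2.1 ∈ T j c.1.1 then
            a c.1.1 (fun i => (c.1.2.1 i : B1Eq324BenfattoLemma.Site d)) c.1.2.2 *
              Real.exp (-(ϰ / 2) * connLength fun i => (c.1.2.1 i : B1Eq324BenfattoLemma.Site d))
          else 0) *
          ∏ kr ∈ ((Finset.univ : Finset (Fin c.1.1)).sigma fun i => Finset.range (c.1.2.2 i)).map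
              ⟨_, legPairs_injective c.1.1⟩,
            z ((fun k : ℕ => if h : k < c.1.1 then (c.1.2.1 ⟨k, h⟩ : B1Eq324BenfattoLemma.Site d)
              else (0 : B1Eq324BenfattoLemma.Site d)) kr.1) := by
  classical
  rw [Finset.sum_coe_sort
    ((Finset.Icc 1 s).sigma fun p => (Finset.univ.filter fun Δ : Fin p → Jr => ∃ j', Δ ∈ T j' p) ×ˢ admissible p D)
    (fun c => (if c.2.1 ∈ T j c.1 then
        a c.1 (fun i => (c.2.1 i : B1Eq324BenfattoLemma.Site d)) c.2.2 *
          Real.exp (-(ϰ / 2) * connLength fun i => (c.2.1 i : B1Eq324BenfattoLemma.Site d)) else 0) *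
      ∏ kr ∈ ((Finset.univ : Finset (Fin c.1)).sigma fun i => Finset.range (c.2.2 i)).map ⟨_, legPairs_injective c.1⟩,
        z ((fun k : ℕ => if h : k < c.1 then (c.2.1 ⟨k, h⟩ : B1Eq324BenfattoLemma.Site d)
          else (0 : B1Eq324BenfattoLemma.Site d)) kr.1)),
    Finset.sum_sigma]
  refine Finset.sum_congr rfl fun p _ => ?_
  rw [Finset.sum_product]
  have hsub : T j p ⊆ Finset.univ.filter fun Δ : Fin p → Jr => ∃ j', Δ ∈ T j' p :=
    fun Δ hΔ => Finset.mem_filter.2 ⟨Finset.mem_univ _, ⟨j, hΔ⟩⟩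
  rw [← Finset.sum_subset hsub]
  · refine Finset.sum_congr rfl fun Δ hΔ => Finset.sum_congr rfl fun n _ => ?_
    rw [if_pos hΔ, term, prod_pow_eq_prod_legs]
  · intro Δ _ hΔ
    exact Finset.sum_eq_zero fun n _ => by rw [if_neg hΔ, zero_mul]

/-- **The weighted coefficient mass of a slot**: for any tuple weight `ω`,
`Σ_{c : ↥U} |a_j(c)|·ω(c) = Σ_{p∈Icc 1 s} Σ_{Δ∈T_j p} Σ_{n∈admissible p D} |A^n_Δ|·e^{−(ϰ/2)d(Δ)}·ω(p,Δ,n)`.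
[cite: BenfattoEtAl1978, (5.5) p.154] -/
theorem sum_abs_tcoef_mul_eq (T : σ → (p : ℕ) → Finset (Fin p → Jr)) (j : σ)
    (ω : ((p : ℕ) × ((Fin p → Jr) × (Fin p → ℕ))) → ℝ) :
    ∑ c : ↥((Finset.Icc 1 s).sigma fun p =>
          (Finset.univ.filter fun Δ : Fin p → Jr => ∃ j', Δ ∈ T j' p) ×ˢ admissible p D),
        |(if c.1.2.1 ∈ T j c.1.1 then
            a c.1.1 (fun i => (c.1.2.1 i : B1Eq324BenfattoLemma.Site d)) c.1.2.2 *
              Real.exp (-(ϰ / 2) * connLength fun i => (c.1.2.1 i : B1Eq324BenfattoLemma.Site d))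
          else 0)| * ω c.1 =
      ∑ p ∈ Finset.Icc 1 s, ∑ Δ ∈ T j p, ∑ n ∈ admissible p D,
        |a p (fun i => (Δ i : B1Eq324BenfattoLemma.Site d)) n| *
          Real.exp (-(ϰ / 2) * connLength fun i => (Δ i : B1Eq324BenfattoLemma.Site d)) * ω ⟨p, (Δ, n)⟩ := by
  classical
  rw [Finset.sum_coe_sort
    ((Finset.Icc 1 s).sigma fun p => (Finset.univ.filter fun Δ : Fin p → Jr => ∃ j', Δ ∈ T j' p) ×ˢ admissible p D)
    (fun c => |(if c.2.1 ∈ T j c.1 then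
        a c.1 (fun i => (c.2.1 i : B1Eq324BenfattoLemma.Site d)) c.2.2 *
          Real.exp (-(ϰ / 2) * connLength fun i => (c.2.1 i : B1Eq324BenfattoLemma.Site d)) else 0)| * ω c),
    Finset.sum_sigma]
  refine Finset.sum_congr rfl fun p _ => ?_
  rw [Finset.sum_product]
  have hsub : T j p ⊆ Finset.univ.filter fun Δ : Fin p → Jr => ∃ j', Δ ∈ T j' p :=
    fun Δ hΔ => Finset.mem_filter.2 ⟨Finset.mem_univ _, ⟨j, hΔ⟩⟩
  rw [← Finset.sum_subset hsub]
  · refine Finset.sum_congr rfl fun Δ hΔ => Finset.sum_congr rfl fun n _ => ?_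
    rw [if_pos hΔ, abs_mul, Real.abs_exp]
  · intro Δ _ hΔ
    exact Finset.sum_eq_zero fun n _ => by rw [if_neg hΔ, abs_zero, zero_mul]

/-- An admissible tuple has at most `D` legs. [cite: BenfattoEtAl1978, (4.5) p.152] -/
theorem card_legs_le_of_mem {p : ℕ} {n : Fin p → ℕ} (hn : n ∈ admissible p D) :
    (((Finset.univ : Finset (Fin p)).sigma fun i => Finset.range (n i)).map ⟨_, legPairs_injective p⟩).card ≤ D := by
  rw [card_legs]
  exact (mem_admissible.1 hn).2

/-- Every leg of a tuple sits at one of its tesserae: for `(k, r)` a leg of `(Δ, n)`, `k < p` and the site read is `Δ_k`.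
[cite: BenfattoEtAl1978, (4.5) p.152] -/
theorem site_of_mem_legs {p : ℕ} {Δ : Fin p → Jr} {n : Fin p → ℕ} {kr : ℕ × ℕ}
    (hkr : kr ∈ ((Finset.univ : Finset (Fin p)).sigma fun i => Finset.range (n i)).map ⟨_, legPairs_injective p⟩) :
    ∃ i : Fin p, (if h : kr.1 < p then (Δ ⟨kr.1, h⟩ : B1Eq324BenfattoLemma.Site d)
      else (0 : B1Eq324BenfattoLemma.Site d)) = (Δ i : B1Eq324BenfattoLemma.Site d) := by
  obtain ⟨⟨i, r⟩, _, rfl⟩ := Finset.mem_map.1 hkr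
  exact ⟨i, by simp only [Function.Embedding.coeFn_mk, Fin.is_lt, dif_pos, Fin.eta]⟩

/-- Every tessera of an admissible tuple carries a leg: `(i, 0)` is a leg when `nᵢ > 0`. [cite: BenfattoEtAl1978, (4.5) p.152] -/
theorem leg_mem_legs_of_mem {p : ℕ} {n : Fin p → ℕ} (hn : n ∈ admissible p D) (i : Fin p) :
    ((i : ℕ), 0) ∈ ((Finset.univ : Finset (Fin p)).sigma fun i => Finset.range (n i)).map ⟨_, legPairs_injective p⟩ :=
  Finset.mem_map.2 ⟨⟨i, 0⟩, Finset.mem_sigma.2 ⟨Finset.mem_univ _, Finset.mem_range.2 ((mem_admissible.1 hn).1 i)⟩, rfl⟩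

/-- **The same slot over `Option ↥U`** (a dummy index `none` with coefficient `0` and no legs, so that the index type is never empty):
`Σ_pΣ_{Δ∈T_j p}Σ_n term = Σ_{c : Option ↥U} a_j(c)·Π_{legs(c)} z`. [cite: BenfattoEtAl1978, (5.5) p.154 and (2.7) p.147] -/
theorem tupleSum_eq_sum_option (T : σ → (p : ℕ) → Finset (Fin p → Jr)) (j : σ) (z : B1Eq324BenfattoLemma.Site d → ℝ) :
    ∑ p ∈ Finset.Icc 1 s, ∑ Δ ∈ T j p, ∑ n ∈ admissible p D, term ϰ a z p Δ n =
      ∑ c : Option ↥((Finset.Icc 1 s).sigma fun p =>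
          (Finset.univ.filter fun Δ : Fin p → Jr => ∃ j', Δ ∈ T j' p) ×ˢ admissible p D),
        (c.elim 0 fun c => if c.1.2.1 ∈ T j c.1.1 then
            a c.1.1 (fun i => (c.1.2.1 i : B1Eq324BenfattoLemma.Site d)) c.1.2.2 *
              Real.exp (-(ϰ / 2) * connLength fun i => (c.1.2.1 i : B1Eq324BenfattoLemma.Site d))
          else 0) *
          ∏ kr ∈ (c.elim (∅ : Finset (ℕ × ℕ)) fun c =>
              ((Finset.univ : Finset (Fin c.1.1)).sigma fun i => Finset.range (c.1.2.2 i)).map ⟨_, legPairs_injective c.1.1⟩),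
            z ((c.elim (fun _ : ℕ => (0 : B1Eq324BenfattoLemma.Site d)) fun c => fun k : ℕ =>
              if h : k < c.1.1 then (c.1.2.1 ⟨k, h⟩ : B1Eq324BenfattoLemma.Site d) else (0 : B1Eq324BenfattoLemma.Site d)) kr.1) := by
  rw [Fintype.sum_option, tupleSum_eq_sum_subtype T j z]
  simp only [Option.elim_none, Option.elim_some, zero_mul, zero_add]

end Reindex

/-! ## §2  (5.31) «(error)» for tuple-class slots -/

section CondFree

variable [DecidableEq σ] [Nonempty σ]

/-- **(5.31) FOR TUPLE-CLASS SLOTS** (the `h31` supplier of `B1Eq324BenfattoSect5PerBox.abs_log_integral_perBox_le_of_colourings` up to the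
χ-removal of `…ChiToOneOnData`): for slots `Y_j = Σ_pΣ_{Δ∈T_j p}Σ_n A^n_Δ e^{−(ϰ/2)d(Δ)} Π z_{Δᵢ}^{nᵢ}`, if on the tesserae of every tuple of every
class `|u| ≤ ε`, `|C^Γ − C| ≤ ε` and `|u|, |C^Γ|, |C| ≤ R` (`R ≥ 1`, `ε ≥ 0`; suppliers: `…LegGeometry` §3–§4, `…CondCentre`, (C.5)–(C.6)),
`|𝓔^T_{z̄}(Y₁,…,Y_k) − 𝓔^T_0(Y₁,…,Y_k)| ≤ (Π_j 𝓜_j)·2^{kD}2^{2^{kD}}·kD·R^{kD}·ε`, `𝓜_j = Σ_{T_j}|A^n_Δ|e^{−(ϰ/2)d(Δ)}`, `k = |σ|`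
(`…PolyClusters.abs_ursellOf_poly_condField_sub_P0_le` on the re-indexing of §1). [cite: BenfattoEtAl1978, (5.31) p.158 and p.153] -/
theorem abs_ursellOf_tupleSums_condField_sub_P0_le (hα : 0 < α) (hβ : 0 < β) (Γ : Finset (B1Eq324BenfattoLemma.Site d))
    (zbar : B1Eq324BenfattoLemma.Site d → ℝ) (T : σ → (p : ℕ) → Finset (Fin p → Jr)) {R ε : ℝ} (hR : 1 ≤ R) (hε : 0 ≤ ε)
    (huR : ∀ j, ∀ p ∈ Finset.Icc 1 s, ∀ Δ ∈ T j p, ∀ i,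
      |condMean (freeCov d α β) Γ zbar (Δ i : B1Eq324BenfattoLemma.Site d)| ≤ R)
    (hCR : ∀ j j', ∀ p ∈ Finset.Icc 1 s, ∀ p' ∈ Finset.Icc 1 s, ∀ Δ ∈ T j p, ∀ Δ' ∈ T j' p', ∀ i i',
      |condCov (freeCov d α β) Γ (Δ i : B1Eq324BenfattoLemma.Site d) (Δ' i' : B1Eq324BenfattoLemma.Site d)| ≤ R)
    (hGR : ∀ j j', ∀ p ∈ Finset.Icc 1 s, ∀ p' ∈ Finset.Icc 1 s, ∀ Δ ∈ T j p, ∀ Δ' ∈ T j' p', ∀ i i',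
      |freeCov d α β (Δ i : B1Eq324BenfattoLemma.Site d) (Δ' i' : B1Eq324BenfattoLemma.Site d)| ≤ R)
    (huε : ∀ j, ∀ p ∈ Finset.Icc 1 s, ∀ Δ ∈ T j p, ∀ i,
      |condMean (freeCov d α β) Γ zbar (Δ i : B1Eq324BenfattoLemma.Site d)| ≤ ε)
    (hCε : ∀ j j', ∀ p ∈ Finset.Icc 1 s, ∀ p' ∈ Finset.Icc 1 s, ∀ Δ ∈ T j p, ∀ Δ' ∈ T j' p', ∀ i i',
      |condCov (freeCov d α β) Γ (Δ i : B1Eq324BenfattoLemma.Site d) (Δ' i' : B1Eq324BenfattoLemma.Site d) -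
        freeCov d α β (Δ i : B1Eq324BenfattoLemma.Site d) (Δ' i' : B1Eq324BenfattoLemma.Site d)| ≤ ε) :
    |ursellOf (fun P : Finset σ => ∫ z, ∏ j ∈ P,
          (∑ p ∈ Finset.Icc 1 s, ∑ Δ ∈ T j p, ∑ n ∈ admissible p D, term ϰ a z p Δ n) ∂condField d α β Γ zbar) Finset.univ -
        ursellOf (fun P : Finset σ => ∫ z, ∏ j ∈ P,
          (∑ p ∈ Finset.Icc 1 s, ∑ Δ ∈ T j p, ∑ n ∈ admissible p D, term ϰ a z p Δ n) ∂P0 d α β) Finset.univ| ≤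
      (∏ j, ∑ p ∈ Finset.Icc 1 s, ∑ Δ ∈ T j p, ∑ n ∈ admissible p D,
          |a p (fun i => (Δ i : B1Eq324BenfattoLemma.Site d)) n| *
            Real.exp (-(ϰ / 2) * connLength fun i => (Δ i : B1Eq324BenfattoLemma.Site d))) *
        (2 ^ (Fintype.card σ * D) * 2 ^ 2 ^ (Fintype.card σ * D) *
          ((Fintype.card σ * D : ℕ) * R ^ (Fintype.card σ * D) * ε)) := by
  classical
  simp_rw [tupleSum_eq_sum_option T]
  -- the tuple data of an index `c ∈ U`
  have hmem : ∀ c : ↥((Finset.Icc 1 s).sigma fun p =>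
      (Finset.univ.filter fun Δ : Fin p → Jr => ∃ j', Δ ∈ T j' p) ×ˢ admissible p D),
      c.1.1 ∈ Finset.Icc 1 s ∧ (∃ j', c.1.2.1 ∈ T j' c.1.1) ∧ c.1.2.2 ∈ admissible c.1.1 D := by
    intro c
    have h := Finset.mem_sigma.1 c.2
    have h2 := Finset.mem_product.1 h.2
    exact ⟨h.1, (Finset.mem_filter.1 h2.1).2, h2.2⟩
  refine (abs_ursellOf_poly_condField_sub_P0_le hα hβ Γ zbar _ _ _ (q := D) ?_ hR hε ?_ ?_ ?_ ?_ ?_).trans (le_of_eq ?_)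
  · rintro j (_ | c)
    · simp only [Option.elim_none, Finset.card_empty]; exact Nat.zero_le _
    · simp only [Option.elim_some]; exact card_legs_le_of_mem (hmem c).2.2
  · rintro j (_ | c) l hl
    · simp only [Option.elim_none, Finset.notMem_empty] at hl
    · simp only [Option.elim_some] at hl ⊢
      obtain ⟨i, hi⟩ := site_of_mem_legs (Jr := Jr) (Δ := c.1.2.1) hl
      obtain ⟨hp, ⟨j', hj'⟩, hn⟩ := hmem c
      rw [hi]; exact huR j' _ hp _ hj' i
  · rintro j (_ | c) j₂ (_ | c') l hl l' hl'
    · simp only [Option.elim_none, Finset.notMem_empty] at hl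
    · simp only [Option.elim_none, Finset.notMem_empty] at hl
    · simp only [Option.elim_none, Finset.notMem_empty] at hl'
    · simp only [Option.elim_some] at hl hl' ⊢
      obtain ⟨i, hi⟩ := site_of_mem_legs (Jr := Jr) (Δ := c.1.2.1) hl
      obtain ⟨i', hi'⟩ := site_of_mem_legs (Jr := Jr) (Δ := c'.1.2.1) hl'
      obtain ⟨hp, ⟨j', hj'⟩, -⟩ := hmem c
      obtain ⟨hp', ⟨j'', hj''⟩, -⟩ := hmem c'
      rw [hi, hi']; exact hCR j' j'' _ hp _ hp' _ hj' _ hj'' i i'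
  · rintro j (_ | c) j₂ (_ | c') l hl l' hl'
    · simp only [Option.elim_none, Finset.notMem_empty] at hl
    · simp only [Option.elim_none, Finset.notMem_empty] at hl
    · simp only [Option.elim_none, Finset.notMem_empty] at hl'
    · simp only [Option.elim_some] at hl hl' ⊢
      obtain ⟨i, hi⟩ := site_of_mem_legs (Jr := Jr) (Δ := c.1.2.1) hl
      obtain ⟨i', hi'⟩ := site_of_mem_legs (Jr := Jr) (Δ := c'.1.2.1) hl'
      obtain ⟨hp, ⟨j', hj'⟩, -⟩ := hmem c
      obtain ⟨hp', ⟨j'', hj''⟩, -⟩ := hmem c'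
      rw [hi, hi']; exact hGR j' j'' _ hp _ hp' _ hj' _ hj'' i i'
  · rintro j (_ | c) l hl
    · simp only [Option.elim_none, Finset.notMem_empty] at hl
    · simp only [Option.elim_some] at hl ⊢
      obtain ⟨i, hi⟩ := site_of_mem_legs (Jr := Jr) (Δ := c.1.2.1) hl
      obtain ⟨hp, ⟨j', hj'⟩, hn⟩ := hmem c
      rw [hi]; exact huε j' _ hp _ hj' i
  · rintro j (_ | c) j₂ (_ | c') l hl l' hl'
    · simp only [Option.elim_none, Finset.notMem_empty] at hl
    · simp only [Option.elim_none, Finset.notMem_empty] at hl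
    · simp only [Option.elim_none, Finset.notMem_empty] at hl'
    · simp only [Option.elim_some] at hl hl' ⊢
      obtain ⟨i, hi⟩ := site_of_mem_legs (Jr := Jr) (Δ := c.1.2.1) hl
      obtain ⟨i', hi'⟩ := site_of_mem_legs (Jr := Jr) (Δ := c'.1.2.1) hl'
      obtain ⟨hp, ⟨j', hj'⟩, -⟩ := hmem c
      obtain ⟨hp', ⟨j'', hj''⟩, -⟩ := hmem c'
      rw [hi, hi']; exact hCε j' j'' _ hp _ hp' _ hj' _ hj'' i i'
  · congr 1
    refine Finset.prod_congr rfl fun j _ => ?_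
    rw [Fintype.sum_option]
    simp only [Option.elim_none, Option.elim_some, abs_zero, zero_add]
    have h := sum_abs_tcoef_mul_eq (s := s) (D := D) (ϰ := ϰ) (a := a) T j (fun _ => (1 : ℝ))
    simp only [mul_one] at h
    exact h

end CondFree

/-! ## §3  The UNIFORM Appendix D bound for tuple-class slots with two separated classes -/

section AppendixD

variable [DecidableEq σ] [Nonempty σ]

omit [Fintype σ] [DecidableEq σ] [Nonempty σ] in
/-- The `ℓ¹` distance of tesserae is a pseudo-distance (cf. `…AppendixDWick` §5). [cite: BenfattoEtAl1978, Appendix C (C.2) p.164] -/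
theorem l1_site_pseudo :
    (∀ t : B1Eq324BenfattoLemma.Site d, (∑ j, |((t j : ℝ) - (t j : ℝ))|) = 0) ∧
    (∀ t t' : B1Eq324BenfattoLemma.Site d, (∑ j, |((t j : ℝ) - (t' j : ℝ))|) = ∑ j, |((t' j : ℝ) - (t j : ℝ))|) ∧
    (∀ t t' t'' : B1Eq324BenfattoLemma.Site d, (∑ j, |((t j : ℝ) - (t'' j : ℝ))|) ≤
      (∑ j, |((t j : ℝ) - (t' j : ℝ))|) + ∑ j, |((t' j : ℝ) - (t'' j : ℝ))|) ∧
    (∀ t t' : B1Eq324BenfattoLemma.Site d, 0 ≤ ∑ j, |((t j : ℝ) - (t' j : ℝ))|) := by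
  refine ⟨fun t => by simp, fun t t' => Finset.sum_congr rfl fun j _ => abs_sub_comm _ _, fun t t' t'' => ?_,
    fun t t' => Finset.sum_nonneg fun j _ => abs_nonneg _⟩
  rw [← Finset.sum_add_distrib]
  exact Finset.sum_le_sum fun j _ => abs_sub_le _ _ _

omit [Fintype σ] [DecidableEq σ] [Nonempty σ] in
/-- **The intra-cluster `ℓ¹` sum of ONE admissible tuple is `≤ D²·(√d·d(Δ) + d)`**: at most `D` legs, any two of them at tesserae of the
tuple, `ℓ¹(Δ_a, Δ_b) ≤ √d·d(Δ) + d` (`…LegGeometry.l1_le_sqrt_mul_connLength_add`). [cite: BenfattoEtAl1978, Appendix D p.166 and (4.5) p.152] -/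
theorem sum_sum_l1_legs_le {p : ℕ} (Δ : Fin p → Jr) {n : Fin p → ℕ} (hn : n ∈ admissible p D) :
    ∑ l ∈ ((Finset.univ : Finset (Fin p)).sigma fun i => Finset.range (n i)).map ⟨_, legPairs_injective p⟩,
      ∑ l' ∈ ((Finset.univ : Finset (Fin p)).sigma fun i => Finset.range (n i)).map ⟨_, legPairs_injective p⟩,
        ∑ j, |(((if h : l.1 < p then (Δ ⟨l.1, h⟩ : B1Eq324BenfattoLemma.Site d) else (0 : B1Eq324BenfattoLemma.Site d)) j : ℝ) -
          ((if h : l'.1 < p then (Δ ⟨l'.1, h⟩ : B1Eq324BenfattoLemma.Site d) else (0 : B1Eq324BenfattoLemma.Site d)) j : ℝ))| ≤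
      (D : ℝ) ^ 2 * (Real.sqrt d * connLength (fun i => (Δ i : B1Eq324BenfattoLemma.Site d)) + d) := by
  set Lg := ((Finset.univ : Finset (Fin p)).sigma fun i => Finset.range (n i)).map ⟨_, legPairs_injective p⟩ with hLg
  set M := Real.sqrt d * connLength (fun i => (Δ i : B1Eq324BenfattoLemma.Site d)) + d with hM
  have hM0 : 0 ≤ M := by
    have := connLength_nonneg (fun i => (Δ i : B1Eq324BenfattoLemma.Site d)); positivity
  have hcard : (Lg.card : ℝ) ≤ D := by exact_mod_cast card_legs_le_of_mem (D := D) hn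
  have hterm : ∀ l ∈ Lg, ∀ l' ∈ Lg,
      ∑ j, |(((if h : l.1 < p then (Δ ⟨l.1, h⟩ : B1Eq324BenfattoLemma.Site d) else (0 : B1Eq324BenfattoLemma.Site d)) j : ℝ) -
        ((if h : l'.1 < p then (Δ ⟨l'.1, h⟩ : B1Eq324BenfattoLemma.Site d) else (0 : B1Eq324BenfattoLemma.Site d)) j : ℝ))| ≤ M := by
    intro l hl l' hl'
    obtain ⟨i, hi⟩ := site_of_mem_legs (Jr := Jr) (Δ := Δ) hl
    obtain ⟨i', hi'⟩ := site_of_mem_legs (Jr := Jr) (Δ := Δ) hl'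
    rw [hi, hi']
    exact l1_le_sqrt_mul_connLength_add (fun i => (Δ i : B1Eq324BenfattoLemma.Site d)) i i'
  calc _ ≤ ∑ l ∈ Lg, (Lg.card : ℝ) * M := by
        refine Finset.sum_le_sum fun l hl => ?_
        refine (Finset.sum_le_card_nsmul Lg _ M fun l' hl' => hterm l hl l' hl').trans ?_
        rw [nsmul_eq_mul]
    _ = (Lg.card : ℝ) * ((Lg.card : ℝ) * M) := by rw [Finset.sum_const, nsmul_eq_mul]
    _ ≤ D * (D * M) := mul_le_mul hcard (mul_le_mul_of_nonneg_right hcard hM0) (by positivity) (Nat.cast_nonneg _)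
    _ = (D : ℝ) ^ 2 * M := by ring

omit [Fintype σ] [DecidableEq σ] [Nonempty σ] in
/-- Monotonicity of the Appendix D constant `2^N·2^{2^N}·K₀^N` in the leg count (`K₀ ≥ 1`). [cite: BenfattoEtAl1978, Appendix D p.166] -/
theorem appDConst_mono {K₀ : ℝ} (hK₀ : 1 ≤ K₀) {N N' : ℕ} (h : N ≤ N') :
    (2 : ℝ) ^ N * 2 ^ 2 ^ N * K₀ ^ N ≤ 2 ^ N' * 2 ^ 2 ^ N' * K₀ ^ N' := by
  have h2 : (2 : ℝ) ^ N ≤ 2 ^ N' := pow_le_pow_right₀ one_le_two h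
  have h22 : (2 : ℝ) ^ 2 ^ N ≤ 2 ^ 2 ^ N' := pow_le_pow_right₀ one_le_two (Nat.pow_le_pow_right two_pos h)
  have hK : K₀ ^ N ≤ K₀ ^ N' := pow_le_pow_right₀ hK₀ h
  have hK0 : 0 ≤ K₀ ^ N := pow_nonneg (zero_le_one.trans hK₀) _
  gcongr

/-- **UNIFORM APPENDIX D, GENERIC POLYNOMIAL SLOTS** (`Z_j = Σ_c a_{jc}·Π_{l∈J_c} z(x_{cl})` over a finite index `ι`, legs at tesserae,
`ℓ¹` pseudo-distance, `d ≥ 1`): if `|u| ≤ K₀` on the legs (`K₀ ≥ max(1, C₀₀)`), every index has `≤ D` legs and intra-cluster `ℓ¹` sum `≤ θ_c`,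
and every colouring `f` with all coefficients `a_{j f(j)} ≠ 0` has a leg of `f(j₁)` and a leg of `f(j₂)` at `ℓ¹` distance `≥ ρ₀`, then
`|𝓔^T_{z̄}(Z₁,…,Z_k)| ≤ 2^{kD}·2^{2^{kD}}·K₀^{kD}·e^{−(δ/2)ρ₀}·Π_j Σ_c |a_{jc}|·e^{(δ/2)θ_c}` for ANY rate `0 ≤ δ ≤ log((2d+α²)/(2d))`
(a weaker rate is what makes `e^{(δ/2)θ_c}` summable against the coefficient decay `e^{−(ϰ/2)d(Δ)}`; print's `ϰ̃ < ϰ`) — colouring by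
colouring through `…PolyClusters.abs_ursellOf_monomials_condField_le_exp`, the propagator decay from `…AppendixDWick.abs_condCov_le_exp_l1`.
[cite: BenfattoEtAl1978, (5.29) p.158 and Appendix D p.166] -/
theorem abs_ursellOf_poly_condField_le_exp_of_separated {ι : Type*} [Fintype ι] [Nonempty ι] {κ : Type}
    (hα : 0 < α) (hβ : 0 < β) (hd : 0 < d) (Γ : Finset (B1Eq324BenfattoLemma.Site d)) (zbar : B1Eq324BenfattoLemma.Site d → ℝ)
    (ac : σ → ι → ℝ) (Jm : ι → Finset κ) (xs : ι → κ → B1Eq324BenfattoLemma.Site d) {K₀ : ℝ} (hK₀ : 1 ≤ K₀)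
    (hK₀' : freeCov d α β 0 0 ≤ K₀) (hu : ∀ c, ∀ l ∈ Jm c, |condMean (freeCov d α β) Γ zbar (xs c l)| ≤ K₀)
    (hq : ∀ c, (Jm c).card ≤ D) (θ : ι → ℝ)
    (hθ : ∀ c, ∑ l ∈ Jm c, ∑ l' ∈ Jm c, ∑ jj, |((xs c l jj : ℝ) - (xs c l' jj : ℝ))| ≤ θ c)
    {δ : ℝ} (hδ : 0 ≤ δ) (hδle : δ ≤ Real.log ((2 * d + α ^ 2) / (2 * d)))
    (j₁ j₂ : σ) {ρ₀ : ℝ}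
    (hsep : ∀ f : σ → ι, (∀ j, ac j (f j) ≠ 0) →
      ∃ l₁ ∈ Jm (f j₁), ∃ l₂ ∈ Jm (f j₂), ρ₀ ≤ ∑ jj, |((xs (f j₁) l₁ jj : ℝ) - (xs (f j₂) l₂ jj : ℝ))|) :
    |ursellOf (fun P : Finset σ => ∫ z, ∏ j ∈ P, (∑ c, ac j c * ∏ l ∈ Jm c, z (xs c l)) ∂condField d α β Γ zbar) Finset.univ| ≤
      2 ^ (Fintype.card σ * D) * 2 ^ 2 ^ (Fintype.card σ * D) * K₀ ^ (Fintype.card σ * D) *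
        Real.exp (-(δ / 2 * ρ₀)) * ∏ j, ∑ c, |ac j c| * Real.exp (δ / 2 * θ c) := by
  haveI := isProbabilityMeasure_condField (d := d) hα hβ Γ zbar
  obtain ⟨h0, hsymm, htri, hnn⟩ := l1_site_pseudo (d := d)
  -- the propagator decay at the weaker rate `δ ≤ log((2d+α²)/(2d))`
  have hCov : ∀ x y : B1Eq324BenfattoLemma.Site d, |condCov (freeCov d α β) Γ x y| ≤
      K₀ * Real.exp (-(δ * ∑ jj, |((x jj : ℝ) - (y jj : ℝ))|)) := by
    intro x y
    refine (abs_condCov_le_exp_l1 hα hβ hd Γ (fun y : B1Eq324BenfattoLemma.Site d => y) x y).trans ?_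
    refine mul_le_mul hK₀' (Real.exp_le_exp.2 ?_) (Real.exp_pos _).le (zero_le_one.trans hK₀)
    have := hnn x y
    nlinarith
  have hm : ∀ (j : σ) (c : ι), AEStronglyMeasurable (fun z : B1Eq324BenfattoLemma.Site d → ℝ => ∏ l ∈ Jm c, z (xs c l))
      (condField d α β Γ zbar) := fun j c => (measurable_monomial (Jm c) (xs c)).aestronglyMeasurable
  have hint : ∀ (j : σ) (c : ι) (q : ℕ), q ≤ Fintype.card σ →
      Integrable (fun z : B1Eq324BenfattoLemma.Site d → ℝ => |∏ l ∈ Jm c, z (xs c l)| ^ q) (condField d α β Γ zbar) :=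
    fun j c q _ => integrable_abs_monomial_pow_condField hα hβ Γ zbar (Jm c) (xs c) q
  rw [ursellOf_poly_eq_sum_colourings (μ := condField d α β Γ zbar) ac
    (fun (_ : σ) (c : ι) (z : B1Eq324BenfattoLemma.Site d → ℝ) => ∏ l ∈ Jm c, z (xs c l)) hm hint]
  set C := (2 : ℝ) ^ (Fintype.card σ * D) * 2 ^ 2 ^ (Fintype.card σ * D) * K₀ ^ (Fintype.card σ * D) with hC
  have hC0 : 0 ≤ C := by positivity
  -- per colouring
  have hf : ∀ f : σ → ι,
      |(∏ j, ac j (f j)) * ursellOf (fun P : Finset σ => ∫ z, ∏ j ∈ P, ∏ l ∈ Jm (f j), z (xs (f j) l)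
        ∂condField d α β Γ zbar) Finset.univ| ≤
        C * Real.exp (-(δ / 2 * ρ₀)) * ∏ j, (|ac j (f j)| * Real.exp (δ / 2 * θ (f j))) := by
    intro f
    by_cases hgood : ∀ j, ac j (f j) ≠ 0
    · obtain ⟨l₁, hl₁, l₂, hl₂, hρ₀⟩ := hsep f hgood
      have hAD := abs_ursellOf_monomials_condField_le_exp hα hβ Γ zbar (fun j => Jm (f j)) (fun j => xs (f j))
        (fun x y : B1Eq324BenfattoLemma.Site d => ∑ jj, |((x jj : ℝ) - (y jj : ℝ))|) h0 hsymm htri hnn hK₀ hδ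
        (fun j l hl => hu (f j) l hl) (fun j j' l _ l' _ => hCov (xs (f j) l) (xs (f j') l')) hl₁ hl₂
      have hN : ∑ j, (Jm (f j)).card ≤ Fintype.card σ * D := by
        calc ∑ j, (Jm (f j)).card ≤ ∑ _j : σ, D := Finset.sum_le_sum fun j _ => hq (f j)
          _ = Fintype.card σ * D := by rw [Finset.sum_const, smul_eq_mul, Finset.card_univ]
      have hI : ∑ j, ∑ l ∈ Jm (f j), ∑ l' ∈ Jm (f j), (∑ jj, |((xs (f j) l jj : ℝ) - (xs (f j) l' jj : ℝ))|) ≤ ∑ j, θ (f j) :=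
        Finset.sum_le_sum fun j _ => hθ (f j)
      have hexp : Real.exp (-(δ / 2 * ((∑ jj, |((xs (f j₁) l₁ jj : ℝ) - (xs (f j₂) l₂ jj : ℝ))|) -
          ∑ j, ∑ l ∈ Jm (f j), ∑ l' ∈ Jm (f j), ∑ jj, |((xs (f j) l jj : ℝ) - (xs (f j) l' jj : ℝ))|))) ≤
          Real.exp (-(δ / 2 * ρ₀)) * ∏ j, Real.exp (δ / 2 * θ (f j)) := by
        rw [← Real.exp_sum, ← Real.exp_add, Real.exp_le_exp, ← Finset.mul_sum]
        nlinarith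
      rw [abs_mul, Finset.abs_prod]
      calc (∏ j, |ac j (f j)|) * |ursellOf (fun P : Finset σ => ∫ z, ∏ j ∈ P, ∏ l ∈ Jm (f j), z (xs (f j) l)
              ∂condField d α β Γ zbar) Finset.univ|
          ≤ (∏ j, |ac j (f j)|) * (C * (Real.exp (-(δ / 2 * ρ₀)) * ∏ j, Real.exp (δ / 2 * θ (f j)))) := by
            refine mul_le_mul_of_nonneg_left (hAD.trans ?_) (Finset.prod_nonneg fun j _ => abs_nonneg _)
            calc (2 : ℝ) ^ (∑ j, (Jm (f j)).card) * 2 ^ 2 ^ (∑ j, (Jm (f j)).card) * (K₀ ^ (∑ j, (Jm (f j)).card) *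
                  Real.exp (-(δ / 2 * ((∑ jj, |((xs (f j₁) l₁ jj : ℝ) - (xs (f j₂) l₂ jj : ℝ))|) -
                    ∑ j, ∑ l ∈ Jm (f j), ∑ l' ∈ Jm (f j), ∑ jj, |((xs (f j) l jj : ℝ) - (xs (f j) l' jj : ℝ))|))))
                = (2 : ℝ) ^ (∑ j, (Jm (f j)).card) * 2 ^ 2 ^ (∑ j, (Jm (f j)).card) * K₀ ^ (∑ j, (Jm (f j)).card) *
                  Real.exp (-(δ / 2 * ((∑ jj, |((xs (f j₁) l₁ jj : ℝ) - (xs (f j₂) l₂ jj : ℝ))|) -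
                    ∑ j, ∑ l ∈ Jm (f j), ∑ l' ∈ Jm (f j), ∑ jj, |((xs (f j) l jj : ℝ) - (xs (f j) l' jj : ℝ))|))) := by
                  ring
              _ ≤ C * (Real.exp (-(δ / 2 * ρ₀)) * ∏ j, Real.exp (δ / 2 * θ (f j))) :=
                  mul_le_mul (appDConst_mono hK₀ hN) hexp (Real.exp_pos _).le hC0
        _ = C * Real.exp (-(δ / 2 * ρ₀)) * ∏ j, (|ac j (f j)| * Real.exp (δ / 2 * θ (f j))) := by
            rw [Finset.prod_mul_distrib]; ring
    · obtain ⟨j, hj⟩ := not_forall.1 hgood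
      have hj : ac j (f j) = 0 := not_ne_iff.1 hj
      have hprod : ∏ j, ac j (f j) = 0 := Finset.prod_eq_zero (Finset.mem_univ j) hj
      have hprod' : ∏ j, (|ac j (f j)| * Real.exp (δ / 2 * θ (f j))) = 0 :=
        Finset.prod_eq_zero (Finset.mem_univ j) (by rw [hj, abs_zero, zero_mul])
      rw [hprod, zero_mul, abs_zero, hprod', mul_zero]
  refine (Finset.abs_sum_le_sum_abs _ _).trans ((Finset.sum_le_sum fun f _ => hf f).trans (le_of_eq ?_))
  rw [← Finset.mul_sum, ← Fintype.prod_sum fun j c => |ac j c| * Real.exp (δ / 2 * θ c)]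

/-- **THE UNIFORM APPENDIX D BOUND FOR TUPLE-CLASS SLOTS WITH TWO SEPARATED CLASSES** (the `h29` / anchored-CROSS supplier): let
`Y_j = Σ_pΣ_{Δ∈T_j p}Σ_n A^n_Δ e^{−(ϰ/2)d(Δ)} Π z_{Δᵢ}^{nᵢ}` (`j ∈ σ`, `k = |σ|`) under `P̄(dz|z̄_Γ)` in dimension `d ≥ 1`, with `|u| ≤ K₀` on the
tesserae of all tuples of all classes and `K₀ ≥ max(1, C₀₀)` ((C.8); the propagator decay `|C^Γ(x,y)| ≤ C₀₀e^{−δℓ¹(x,y)}`,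
`δ = log((2d+α²)/(2d))`, is (C.2)+(C.6), `…AppendixDWick.abs_condCov_le_exp_l1`).  If every tuple of the class of slot `j₁` meets a region
`R_A` and every tuple of the class of slot `j₂` meets `R_B`, with `ℓ¹(x, y) ≥ ρ₀` for `x ∈ R_A`, `y ∈ R_B`, then
`|𝓔^T_{z̄}(Y₁,…,Y_k)| ≤ 2^{kD}·2^{2^{kD}}·K₀^{kD}·e^{−(δ/2)ρ₀}·Π_j 𝓜̃_j`, `𝓜̃_j = Σ_{T_j}|A^n_Δ|e^{−(ϰ/2)d(Δ)}·e^{(δ/2)D²(√d·d(Δ)+d)}`,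
for ANY rate `0 ≤ δ ≤ log((2d+α²)/(2d))` (take `δ < ϰ/(D²√d)` to keep `𝓜̃_j` summable — print's `ϰ̃`)
(`abs_ursellOf_poly_condField_le_exp_of_separated` on the re-indexing of §1; designated legs at the tesserae in `R_A`, `R_B` — admissible
exponents are positive; intra-cluster sums by `sum_sum_l1_legs_le`).  Print: `R_A = □′∖Γ₄(□)` (a leg of `Ψ″₁`), `R_B = Γ₁(□)∪Γ₂(□)` (a leg of
`Ψ₂`), `ρ₀ = v + 1`, `v = ½b^{3/2}` ⟹ the factor `e^{−ϰ̃b^{3/2}}` of (5.29). [cite: BenfattoEtAl1978, (5.29) p.158 and Appendix D p.166] -/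
theorem abs_ursellOf_tupleSums_condField_le_exp_of_separated (hα : 0 < α) (hβ : 0 < β) (hd : 0 < d)
    (Γ : Finset (B1Eq324BenfattoLemma.Site d)) (zbar : B1Eq324BenfattoLemma.Site d → ℝ)
    (T : σ → (p : ℕ) → Finset (Fin p → Jr)) {K₀ : ℝ} (hK₀ : 1 ≤ K₀) (hK₀' : freeCov d α β 0 0 ≤ K₀)
    (hu : ∀ j, ∀ p ∈ Finset.Icc 1 s, ∀ Δ ∈ T j p, ∀ i,
      |condMean (freeCov d α β) Γ zbar (Δ i : B1Eq324BenfattoLemma.Site d)| ≤ K₀)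
    {δ : ℝ} (hδ : 0 ≤ δ) (hδle : δ ≤ Real.log ((2 * d + α ^ 2) / (2 * d)))
    (j₁ j₂ : σ) (RA RB : Set (B1Eq324BenfattoLemma.Site d)) {ρ₀ : ℝ}
    (hA : ∀ p ∈ Finset.Icc 1 s, ∀ Δ ∈ T j₁ p, ∃ i, (Δ i : B1Eq324BenfattoLemma.Site d) ∈ RA)
    (hB : ∀ p ∈ Finset.Icc 1 s, ∀ Δ ∈ T j₂ p, ∃ i, (Δ i : B1Eq324BenfattoLemma.Site d) ∈ RB)
    (hρ : ∀ x ∈ RA, ∀ y ∈ RB, ρ₀ ≤ ∑ j, |((x j : ℝ) - (y j : ℝ))|) :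
    |ursellOf (fun P : Finset σ => ∫ z, ∏ j ∈ P,
        (∑ p ∈ Finset.Icc 1 s, ∑ Δ ∈ T j p, ∑ n ∈ admissible p D, term ϰ a z p Δ n) ∂condField d α β Γ zbar) Finset.univ| ≤
      2 ^ (Fintype.card σ * D) * 2 ^ 2 ^ (Fintype.card σ * D) * K₀ ^ (Fintype.card σ * D) * Real.exp (-(δ / 2 * ρ₀)) *
        ∏ j, ∑ p ∈ Finset.Icc 1 s, ∑ Δ ∈ T j p, ∑ n ∈ admissible p D,
          |a p (fun i => (Δ i : B1Eq324BenfattoLemma.Site d)) n| *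
            Real.exp (-(ϰ / 2) * connLength fun i => (Δ i : B1Eq324BenfattoLemma.Site d)) *
            Real.exp (δ / 2 * ((D : ℝ) ^ 2 * (Real.sqrt d * connLength (fun i => (Δ i : B1Eq324BenfattoLemma.Site d)) + d))) := by
  classical
  simp_rw [tupleSum_eq_sum_option T]
  have hmem : ∀ c : ↥((Finset.Icc 1 s).sigma fun p =>
      (Finset.univ.filter fun Δ : Fin p → Jr => ∃ j', Δ ∈ T j' p) ×ˢ admissible p D),
      c.1.1 ∈ Finset.Icc 1 s ∧ (∃ j', c.1.2.1 ∈ T j' c.1.1) ∧ c.1.2.2 ∈ admissible c.1.1 D := by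
    intro c
    have h := Finset.mem_sigma.1 c.2
    have h2 := Finset.mem_product.1 h.2
    exact ⟨h.1, (Finset.mem_filter.1 h2.1).2, h2.2⟩
  refine (abs_ursellOf_poly_condField_le_exp_of_separated (D := D) (ρ₀ := ρ₀) hα hβ hd Γ zbar _ _ _ hK₀ hK₀' ?_ ?_
    (fun c : Option ↥((Finset.Icc 1 s).sigma fun p =>
        (Finset.univ.filter fun Δ : Fin p → Jr => ∃ j', Δ ∈ T j' p) ×ˢ admissible p D) => c.elim 0 fun c =>
      (D : ℝ) ^ 2 * (Real.sqrt d * connLength (fun i => (c.1.2.1 i : B1Eq324BenfattoLemma.Site d)) + d)) ?_ hδ hδle j₁ j₂ ?_).trans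
    (le_of_eq ?_)
  · rintro (_ | c) l hl
    · simp only [Option.elim_none, Finset.notMem_empty] at hl
    · simp only [Option.elim_some] at hl ⊢
      obtain ⟨i, hi⟩ := site_of_mem_legs (Jr := Jr) (Δ := c.1.2.1) hl
      obtain ⟨hp, ⟨j', hj'⟩, -⟩ := hmem c
      rw [hi]; exact hu j' _ hp _ hj' i
  · rintro (_ | c)
    · simp only [Option.elim_none, Finset.card_empty]; exact Nat.zero_le _
    · simp only [Option.elim_some]; exact card_legs_le_of_mem (hmem c).2.2
  · rintro (_ | c)
    · simp only [Option.elim_none, Finset.sum_empty]; exact le_rfl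
    · simp only [Option.elim_some]
      exact sum_sum_l1_legs_le (D := D) c.1.2.1 (hmem c).2.2
  · intro f hf
    -- every chosen index is a tuple of its own class
    have hcls : ∀ j, ∃ c, f j = some c ∧ c.1.2.1 ∈ T j c.1.1 := by
      intro j
      have h := hf j
      rcases hfj : f j with _ | c
      · rw [hfj] at h; exact absurd rfl h
      · rw [hfj] at h
        simp only [Option.elim_some] at h
        by_cases hc : c.1.2.1 ∈ T j c.1.1
        · exact ⟨c, rfl, hc⟩
        · exact absurd (if_neg hc) h
    obtain ⟨c₁, hc₁, hT₁⟩ := hcls j₁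
    obtain ⟨c₂, hc₂, hT₂⟩ := hcls j₂
    obtain ⟨i₁, hi₁⟩ := hA _ (hmem c₁).1 _ hT₁
    obtain ⟨i₂, hi₂⟩ := hB _ (hmem c₂).1 _ hT₂
    refine ⟨((i₁ : ℕ), 0), ?_, ((i₂ : ℕ), 0), ?_, ?_⟩
    · rw [hc₁]; exact leg_mem_legs_of_mem (hmem c₁).2.2 i₁
    · rw [hc₂]; exact leg_mem_legs_of_mem (hmem c₂).2.2 i₂
    · rw [hc₁, hc₂]
      simp only [Option.elim_some, Fin.is_lt, dif_pos, Fin.eta]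
      exact hρ _ hi₁ _ hi₂
  · congr 1
    refine Finset.prod_congr rfl fun j _ => ?_
    rw [Fintype.sum_option]
    simp only [Option.elim_none, Option.elim_some, abs_zero, zero_mul, zero_add]
    exact sum_abs_tcoef_mul_eq (s := s) (D := D) (ϰ := ϰ) (a := a) T j
      (fun c => Real.exp (δ / 2 * ((D : ℝ) ^ 2 * (Real.sqrt d * connLength (fun i => (c.2.1 i : B1Eq324BenfattoLemma.Site d)) + d))))

end AppendixD

end Literature.MathematicalPhysics.QuantumFieldTheory.Balaban1983to89.B1Eq324BenfattoSect5TupleClusters
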